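import Literature.AnabelianGeometry.EtaleTheta.SettingModelTateCensusClauses
import Literature.AnabelianGeometry.EtaleTheta.SettingModelTateTheta
import Literature.AnabelianGeometry.EtaleTheta.SettingModel2InversionCoverings
import Literature.AnabelianGeometry.EtaleTheta.SettingModelChiTwistedSections
import Literature.AnabelianGeometry.EtaleTheta.ThetaCohomologyInversion
import HarnessLib

/-!
# The STAGE-2 model: the cocycle-corrected inversion IS an inversion automorphism ([EtTh] Prop. 1.5 (iii)
# `IsInversionAut`, second constructor site; proof-only)

Mochizuki, *The étale theta function …*, Publ. RIMS **45** (2009) [EtTh], Prop. 1.5 (iii) p. 23 («any inversion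
automorphism ι …»), §1 pp. 13–14 (`Y_N`, `Z_N`) [cite: MochizukiEtTh2009, Prop 1.5 (iii) p.23].  abc-iut cell, layer L2,
prover abc-iut-L2-d1 (gen 5); PROOF-ONLY stage-2 twin of this seat's `SettingModelChiInversionAut` (census C11a), over
abc-iut-L2-t5's `ThetaSetting.modelχq p i j hj` (`Π^tp_X = Γ ⋊_{actχq} G_{ℚ_p}`, `Π^tp_{Y_N} = Δ^tp_{Y_N} ⋊ G_{K_N}`,
`Π^tp_{Z_N} = Δ^tp_{Z_N} ⋊ G_{J_N}`, `SettingModelTateTheta`), abc-iut-w5-d249's cocycle-corrected inversion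
`inversionχq p i j : (γ, σ) ↦ (ι_Γ γ · b^{κ_p(σ)^{j−2i}}, σ)` (`SettingModelTateInversion`) and (R1e′) at stage 2
(`toHat_inversionχq_mul_self_mem`, `SettingModelTateCensusClauses`), and abc-iut-L2-t1's predicate
`ThetaSetting.IsInversionAut` (`ThetaCohomologyInversion`).

The one new computation: the DEFECT `b^{κ_p(σ)^{j−2i}}` is invisible at level `N` on `Π^tp_{Y_N}` — for `σ ∈ G_{K_N}`
and even `j` the exponent `(j − 2i)·κ_p(σ)` dies mod `N` (`level_kappaP_zpow_eq_one_of_mem_GKNq`), and on `G_{J_N}`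
already `κ_p(σ) ≡ 0 (N)` (`apply_pRoot_of_mem_GJNq`) — so there the levels of `(ι g).left` are `negXY` of those of
`g.left` (`levelHom_left_inversionχq_of_level`).  Hence **`inversionχq_mem_YNχq_iff`**, **`inversionχq_mem_ZNχq_iff`**,
`map_YNχq_inversionχq`, `map_ZNχq_inversionχq`, `thetaToEll_toTheta_inversionχq` (`−1` on `(Δ^tp_X)^ell`), and
**`isInversionAut_inversionχq`**: `IsInversionAut (inversionχq p i j)` at `modelχq p i j hj`; (R1e′) / Thm 1.6 (i) /
«`ι^Θ = id` on `Δ_Θ`» follow BY NAME from abc-iut-L2-t1's API (`thm16i_inversionχq`, `map_GtpY_inversionχq`,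
`map_GtpYddN_inversionχq`, …); NV
`ThetaSetting.exists_isEtThOrigin_and_isInversionAut_stageTwo`.
SEMI-SYNTHETIC MODEL, consistency evidence only; nothing of [EtTh] asserted; no side taken on [IUTchIII] Cor. 3.12.
-/

noncomputable section

namespace Literature.AnabelianGeometry.EtaleTheta.SettingModel

open Literature.AnabelianGeometry.SemiGraphs _root_.Function

variable (p : ℕ) [Fact p.Prime] (i j : ℤ)

/-! ### The defect exponent dies at level `N` on `G_{K_N}` (even `j`) and on `G_{J_N}` -/

/-- `j − 2i` is even for even `j`. [cite: MochizukiEtTh2009, §1 p.13] -/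
theorem even_neg_add_neg_add {j : ℤ} (hj : Even j) (i : ℤ) : Even (-i + -i + j) :=
  Even.add ⟨-i, rfl⟩ hj

/-- **On `G_{K_N}` the defect exponent `κ_p(σ)^{j−2i}` dies mod `N`** (even `j`: `j − 2i` is even and `κ_p² ≡ 0 (N)` on
`G_{K_N}`, `K_N ∋ q^{1/N} = p^{2/N}`). [cite: MochizukiEtTh2009, §1 p.13] -/
theorem level_invDefect_tatePairHom_of_mem_GKNq (hj : Even j) {σ : GQp p} {N : ℕ+}
    (hσ : σ ∈ (fieldKN ⊥ (qModel p) N).fixingSubgroup) :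
    ZHatLevel.level N (invDefect (tatePairHom p i j σ)) = 1 := by
  rw [invDefect_tatePairHom]
  exact level_kappaP_zpow_eq_one_of_mem_GKNq p (-i + -i + j) (even_neg_add_neg_add hj i) hσ

/-- **On `G_{J_N}` the defect exponent dies mod `N`** (all `i, j`: `p^{1/N} ∈ J_N`, so `κ_p ≡ 0 (N)`).
[cite: MochizukiEtTh2009, §1 p.14] -/
theorem level_invDefect_tatePairHom_of_mem_GJNq {σ : GQp p} {N : ℕ+}
    (hσ : σ ∈ (fieldJN ⊥ (qModel p) N).fixingSubgroup) :
    ZHatLevel.level N (invDefect (tatePairHom p i j σ)) = 1 := by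
  rw [invDefect_tatePairHom, map_zpow, (level_kappaP_eq_one_iff p σ N).mpr (apply_pRoot_of_mem_GJNq p hσ), one_zpow]

/-- **Where the defect dies, `ι` acts on levels by `negXY`**: `levelHom N (ι g).left = negXY (levelHom N g.left)` whenever
`κ_p(g.right)^{j−2i} ≡ 0 (N)`. [cite: MochizukiEtTh2009, Prop 2.2 (i) p.37] -/
theorem levelHom_left_inversionχq_of_level (g : PiTpχq p i j) {N : ℕ+}
    (h : ZHatLevel.level N (invDefect (tatePairHom p i j g.right)) = 1) :
    levelHom N (inversionχq p i j g).left = Heis.negXY (levelHom N g.left) := by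
  rw [inversionχq_apply, tateInversion_left, map_mul, levelHom_gfpInv, levelHom_bPowGfp, h, toAdd_one]
  ext <;> simp

/-- `pr₂ (ι g).left = (pr₂ g.left)⁻¹`: `(ι g).left ∈ Ker pr₂ ↔ g.left ∈ Ker pr₂`. [cite: MochizukiEtTh2009, §1 p.13] -/
theorem left_inversionχq_mem_ker_gfpSnd_iff (g : PiTpχq p i j) :
    (inversionχq p i j g).left ∈ gfpSnd.ker ↔ g.left ∈ gfpSnd.ker := by
  rw [MonoidHom.mem_ker, MonoidHom.mem_ker, gfpSnd_left_inversionχq, inv_eq_one]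

/-! ### `ι` preserves `Π^tp_{Y_N}` and `Π^tp_{Z_N}` -/

/-- **`ι(g) ∈ Π^tp_{Y_N} ↔ g ∈ Π^tp_{Y_N}`** at the stage-2 model (even `j`): the Galois factor is unchanged, and over
`G_{K_N}` the levels of `(ι g).left` are `negXY` of those of `g.left`. [cite: MochizukiEtTh2009, §1 p.13] -/
theorem inversionχq_mem_YNχq_iff (hj : Even j) (N : ℕ+) (g : PiTpχq p i j) :
    inversionχq p i j g ∈ YNχq p i j N ↔ g ∈ YNχq p i j N := by
  change (inversionχq p i j g).left ∈ dY N ∧ (inversionχq p i j g).right ∈ (fieldKN ⊥ (qModel p) N).fixingSubgroup ↔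
    g.left ∈ dY N ∧ g.right ∈ (fieldKN ⊥ (qModel p) N).fixingSubgroup
  rw [show (inversionχq p i j g).right = g.right from rfl]
  refine and_congr_left fun hσ => ?_
  change (inversionχq p i j g).left ∈ gfpSnd.ker ⊓ (Heis.zAxis : Subgroup (Heis (ZMod N))).comap (levelHom N) ↔
    g.left ∈ gfpSnd.ker ⊓ (Heis.zAxis : Subgroup (Heis (ZMod N))).comap (levelHom N)
  rw [Subgroup.mem_inf, Subgroup.mem_inf, Subgroup.mem_comap, Subgroup.mem_comap, left_inversionχq_mem_ker_gfpSnd_iff,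
    levelHom_left_inversionχq_of_level p i j g (level_invDefect_tatePairHom_of_mem_GKNq p i j hj hσ),
    Heis.negXY_mem_zAxis_iff]

/-- **`ι(g) ∈ Π^tp_{Z_N} ↔ g ∈ Π^tp_{Z_N}`** at the stage-2 model (all `i, j`): over `G_{J_N}` the defect dies mod `N`.
[cite: MochizukiEtTh2009, §1 p.14] -/
theorem inversionχq_mem_ZNχq_iff (N : ℕ+) (g : PiTpχq p i j) :
    inversionχq p i j g ∈ ZNχq p i j N ↔ g ∈ ZNχq p i j N := by
  change (inversionχq p i j g).left ∈ dZ N ∧ (inversionχq p i j g).right ∈ (fieldJN ⊥ (qModel p) N).fixingSubgroup ↔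
    g.left ∈ dZ N ∧ g.right ∈ (fieldJN ⊥ (qModel p) N).fixingSubgroup
  rw [show (inversionχq p i j g).right = g.right from rfl]
  refine and_congr_left fun hσ => ?_
  change (inversionχq p i j g).left ∈ gfpSnd.ker ⊓ (levelHom N).ker ↔ g.left ∈ gfpSnd.ker ⊓ (levelHom N).ker
  rw [Subgroup.mem_inf, Subgroup.mem_inf, MonoidHom.mem_ker (f := levelHom N), MonoidHom.mem_ker (f := levelHom N),
    left_inversionχq_mem_ker_gfpSnd_iff,
    levelHom_left_inversionχq_of_level p i j g (level_invDefect_tatePairHom_of_mem_GJNq p i j hσ),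
    Heis.negXY_eq_one_iff]

/-- **`ι(Π^tp_{Y_N}) = Π^tp_{Y_N}`** at the stage-2 model (even `j`). [cite: MochizukiEtTh2009, §1 p.13] -/
theorem map_YNχq_inversionχq (hj : Even j) (N : ℕ+) :
    (YNχq p i j N).map (inversionχq p i j).toMulEquiv.toMonoidHom = YNχq p i j N := by
  ext g
  constructor
  · rintro ⟨h, hh, rfl⟩
    exact (inversionχq_mem_YNχq_iff p i j hj N h).mpr hh
  · intro hg
    exact ⟨inversionχq p i j g, (inversionχq_mem_YNχq_iff p i j hj N _).mpr hg, inversionχq_inversionχq p i j g⟩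

/-- **`ι(Π^tp_{Z_N}) = Π^tp_{Z_N}`** at the stage-2 model. [cite: MochizukiEtTh2009, §1 p.14] -/
theorem map_ZNχq_inversionχq (N : ℕ+) :
    (ZNχq p i j N).map (inversionχq p i j).toMulEquiv.toMonoidHom = ZNχq p i j N := by
  ext g
  constructor
  · rintro ⟨h, hh, rfl⟩
    exact (inversionχq_mem_ZNχq_iff p i j N h).mpr hh
  · intro hg
    exact ⟨inversionχq p i j g, (inversionχq_mem_ZNχq_iff p i j N _).mpr hg, inversionχq_inversionχq p i j g⟩

/-! ### `−1` on `(Δ^tp_X)^ell` -/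

/-- `ι(g) · g ∈ Ker(Π^tp_X ↠ (Π^tp_X)^ell)` for `g ∈ Δ^tp_X` (abc-iut's `toHat_inversionχq_mul_self_mem`, (R1e′) on the
dense part). [cite: MochizukiEtTh2009, Prop 2.2 (i) p.37] -/
theorem inversionχq_mul_self_mem_ellKer {g : PiTpχq p i j} (hg : g ∈ (curveχq p i j).DeltaTemp) :
    inversionχq p i j g * g ∈ CurveTheta.ellKer (curveχq p i j) :=
  toHat_inversionχq_mul_self_mem p i j hg

/-- **`ι` acts by `−1` on `(Δ^tp_X)^ell`** at the stage-2 model: `(ι g)^ell = (g^ell)⁻¹` for `g ∈ Δ^tp_X`.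
[cite: MochizukiEtTh2009, Prop 1.5 (iii) p.23] -/
theorem thetaToEll_toTheta_inversionχq {g : PiTpχq p i j} (hg : g ∈ (curveχq p i j).DeltaTemp) :
    CurveTheta.thetaToEll (curveχq p i j) (CurveTheta.toTheta (curveχq p i j) (inversionχq p i j g)) =
      (CurveTheta.thetaToEll (curveχq p i j) (CurveTheta.toTheta (curveχq p i j) g))⁻¹ := by
  rw [eq_inv_iff_mul_eq_one, ← map_mul, ← map_mul, ← MonoidHom.comp_apply, ← MonoidHom.mem_ker,
    CurveTheta.ker_toEll]
  exact inversionχq_mul_self_mem_ellKer p i j hg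

/-! ### The instance -/

variable (hj : Even j)

/-- **The cocycle-corrected inversion of the stage-2 model IS an inversion automorphism** in the sense of
abc-iut-L2-t1's `ThetaSetting.IsInversionAut` (Prop. 1.5 (iii)): over `K`, `−1` on `Z`, `−1` on `(Δ^tp_X)^ell`,
preserving every `Π^tp_{Y_N}` (even `j`) and `Π^tp_{Z_N}`. [cite: MochizukiEtTh2009, Prop 1.5 (iii) p.23] -/
theorem isInversionAut_inversionχq : (ThetaSetting.modelχq p i j hj).IsInversionAut (inversionχq p i j) where
  aug_apply g := augχq_inversionχq p i j g
  toZ_apply g := gfpSnd_left_inversionχq p i j g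
  ell_apply _ hg := thetaToEll_toTheta_inversionχq p i j hg
  map_GtpYN N := map_YNχq_inversionχq p i j hj N
  map_GtpZN N := map_ZNχq_inversionχq p i j N

/-- Its inverse (= itself) is an inversion automorphism too (abc-iut-L2-t1's `IsInversionAut.symm`).
[cite: MochizukiEtTh2009, Prop 1.5 (iii) p.23] -/
theorem isInversionAut_inversionχq_symm :
    (ThetaSetting.modelχq p i j hj).IsInversionAut (inversionχq p i j).symm :=
  (isInversionAut_inversionχq p i j hj).symm

/-- **Thm. 1.6 (i) for the stage-2 inversion** (`ι(Π^tp_Ÿ) = Π^tp_Ÿ`), BY NAME from `IsInversionAut.thm16i`.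
[cite: MochizukiEtTh2009, Thm 1.6 (i) p.24] -/
theorem thm16i_inversionχq :
    ThetaSetting.Thm16i (Dα := ThetaSetting.modelχq p i j hj) (Dβ := ThetaSetting.modelχq p i j hj) (inversionχq p i j) :=
  (isInversionAut_inversionχq p i j hj).thm16i

/-- `ι(Π^tp_Y) = Π^tp_Y` at the stage-2 model, BY NAME. [cite: MochizukiEtTh2009, §1 p.13] -/
theorem map_GtpY_inversionχq :
    (ThetaSetting.modelχq p i j hj).GtpY.map (inversionχq p i j).toMulEquiv.toMonoidHom =
      (ThetaSetting.modelχq p i j hj).GtpY :=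
  (isInversionAut_inversionχq p i j hj).map_GtpY

/-- `ι(Π^tp_{Ÿ_N}) = Π^tp_{Ÿ_N}` at the stage-2 model, BY NAME. [cite: MochizukiEtTh2009, §1 p.17] -/
theorem map_GtpYddN_inversionχq (N : ℕ+) :
    ((ThetaSetting.modelχq p i j hj).GtpYddN N).map (inversionχq p i j).toMulEquiv.toMonoidHom =
      (ThetaSetting.modelχq p i j hj).GtpYddN N :=
  (isInversionAut_inversionχq p i j hj).map_GtpYddN N

/-- **NV (stage 2)**: for every prime `p`, all `i` and even `j`, the stage-2 model is a Theta setting of [EtTh] origin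
admitting an inversion automorphism in the sense of Prop. 1.5 (iii). [cite: MochizukiEtTh2009, Prop 1.5 (iii) p.23] -/
theorem _root_.Literature.AnabelianGeometry.EtaleTheta.ThetaSetting.exists_isEtThOrigin_and_isInversionAut_stageTwo :
    ∃ (D : ThetaSetting p) (ι : D.PiTemp ≃ₜ* D.PiTemp), D = ThetaSetting.modelχq p i j hj ∧ D.IsEtThOrigin ∧
      D.IsInversionAut ι :=
  ⟨ThetaSetting.modelχq p i j hj, inversionχq p i j, rfl, ThetaSetting.modelχq_isEtThOrigin p i j hj,
    isInversionAut_inversionχq p i j hj⟩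

end Literature.AnabelianGeometry.EtaleTheta.SettingModel

end
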